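import Literature.AlgebraicGeometry.AbelianSchemes.AbelianSchemeFibreFrobeniusTwistHom   -- ★ (d2) p845045 (A-p14): `conjFibreIso` ∕ `fibreFrobeniusTwistIso` hom squares
import Literature.AlgebraicGeometry.AbelianSchemes.AbelianSchemeFibreBaseChangeHom       -- ★ (d4) p845093 (A-p14): `fibreBaseChangeIso` hom squares
import Literature.AlgebraicGeometry.GroupSchemes.GroupSchemeKernel                       -- ★ `ker` ∕ `kerι` ∕ `kerLift`
import HarnessLib

/-!
# Kernels and finite subgroups under the fibre identifications: points of `ker f` and the kernel group scheme are
# transported along the conjugate ∕ Frobenius ∕ base-change identifications of fibres WITH structures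
# (Milne, *Shimura varieties* §14; Shimura 1998 §18.6; Görtz–Wedhorn (4.15), Def. 4.45)

Topic `AlgebraicGeometry/AbelianSchemes`; namespaces `Literature.AlgebraicGeometry.Motives.AbelianVariety` (§0, §4: generic) and
`Literature.AlgebraicGeometry.AbelianSchemes.AbelianSchemeOver` (§1–§3, §5).  KERNEL ONLY: theorems; **no definition, no named fact, no
instance, no notation, no `sorry`**.  Cell `pub/hodgecm-mathlib`, programme P6 («MOD»), organ **(d6)** of the DICT desk F0P6c-plan (g0)
(2026-09-01 15:02Z, A-p14 (g31)'s (d1)–(d5) lineage): the KERNEL ∕ `Sub`-reading transport needed when HEART's `Sub x̄` ∕ `sp` ∕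
`IsEtale` fields move a line or a finite subgroup by `σ̃`, `F̃`, or restrict it.  HC_CM is proved only modulo the printed citations
until rung 0 closes; this file changes no count.

## Mathematics

A commutative square of homomorphisms of abelian varieties `f ≫ e_B = e_A ≫ f′` whose horizontal maps `e_A : A ≅ A′`,
`e_B : B ≅ B′` are ISOMORPHISMS identifies kernels: on points, `f(P) = 1 ↔ f′(e_A(P)) = 1` (`e_B` is an injective group
homomorphism on points) and `e_A` maps `{P ∣ f(P) = 1}` ONTO `{Q ∣ f′(Q) = 1}`; on group schemes, `Ker f ≅ Ker f′` over `e_A`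
(the universal property of ★ `GroupSchemeKernel.ker`).  The tree's three fibre identifications of an abelian scheme WITH its
homomorphisms are such squares: ★ `conjugate_fibreHom_comp_conjFibreIso_hom` (`(f_s)^σ ≫ e_B = e_A ≫ f_{Spec σ ≫ s}`, with
`P ↦ P^σ` = ★ `conjPoints` a GROUP isomorphism `A_s(L) ≃* (A_s)^σ(L)`), ★ `fibreHom_comp_fibreFrobeniusTwistIso_hom`
(`f_{x ≫ F_S} ≫ e_B = e_A ≫ (f_x)^{(q)}`), ★ `fibreHom_baseChangeHom_comp_fibreBaseChangeIso_hom` (`(f ×_S S′)_t ≫ e_B = e_A ≫ f_{t ≫ g}`).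
So: the points of `ker f_s` killed ∕ the finite subgroups of `A_s` are carried by `σ` onto those of `A_{Spec σ ≫ s}` for `f_{Spec σ ≫ s}`
(Milne's «`σ(A, i, λ, ηK)`» for kernels and level subgroups), the points of `ker f` at the Frobenius-moved point `F(x̄)` are those of
`ker (f_x̄)^{(q)}` (Shimura's «`β^f`»), and restriction to `S′` does not change them.

## Contents
* §0 GENERIC (abelian varieties over any field `K`, points in any field `Ω ⊇ K`): `map_hom_one`, `map_iso_hom_injective`,
  **`map_iso_hom_eq_one_iff`**, **`map_eq_one_iff_of_sq`** (kernel transport along a square with iso sides), `image_ker_eq_of_sq`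
  (`e_A '' {f = 1} = {f′ = 1}`);
* §1 CONJUGATE: `map_fibreHom_specTwist_eq_one_iff` (points of `(A_s)^σ`), **`map_fibreHom_eq_one_iff_conjPoints`**
  (`f_s(P) = 1 ↔ f_{Spec σ ≫ s}(e_A(P^σ)) = 1`), `image_conj_ker_eq`;
* §2 FROBENIUS: **`map_fibreHom_frobeniusOver_eq_one_iff`** (`f_{x ≫ F_S}(Q) = 1 ↔ (f_x)^{(q)}(e_A Q) = 1`), `image_frobenius_ker_eq`;
* §3 BASE CHANGE: **`map_fibreHom_baseChangeHom_eq_one_iff`**, `image_baseChange_ker_eq`;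
* §4 GENERIC SCHEME FORM: **`exists_kerIso_of_sq`** — `Ker φ ≅ Ker φ′` over `e_G` for a square `φ ≫ e_H = e_G ≫ φ′` of homomorphisms of
  group objects with iso sides (any cartesian monoidal category; ★ `kerLift`), and its abelian-variety form `exists_kerIso_of_av_sq`;
* §5 the three instances `exists_kerIso_fibreHom_specTwist` ∕ `_frobeniusOver` ∕ `_baseChangeHom`.

## References
* [Milne2005ShimuraVarieties] J. S. Milne, *Introduction to Shimura varieties*, §11 p. 108 («`σP ∈ σA(Ω)`»), §14 pp. 124–125
  («`σ(A, i, λ, ηK) = (σA, σi, σλ, σηK)`» — the level subgroup `ηK` moves with `σ`).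
* [Shimura1998] G. Shimura, *Abelian varieties with complex multiplication and modular functions*, §18.6 proof of Thm. 18.6,
  pp. 127–128 («`β^f`», «`(t^σ)~ = π(t̃)`» for points of finite order).
* [GortzWedhorn2020] U. Görtz, T. Wedhorn, *Algebraic Geometry I* (2nd ed.), (4.15) and Definition 4.45 (2) (kernels of
  homomorphisms of group schemes), Section (4.7), Prop. 4.16 (transitivity of base change).
-/

set_option autoImplicit false

noncomputable section

-- `(specOver k L).left = Spec L`, `A.frobeniusTwist p r = A.conjugate (Frob^r)` etc. are definitional only above `instances`
-- transparency (as in ★ `AbelianSchemeFibreFrobeniusTwistHom`).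
set_option backward.isDefEq.respectTransparency false

universe v u

open CategoryTheory CategoryTheory.Limits AlgebraicGeometry MonoidalCategory CartesianMonoidalCategory

/-! ## §0 Generic: kernels on points along a square with isomorphism sides -/

namespace Literature.AlgebraicGeometry.Motives

namespace AbelianVariety

open scoped MonObj

variable {K : Type u} [Field K] {A B A' B' : AbelianVariety K} {Ω : Type u} [Field Ω] [Algebra K Ω]

/-- A homomorphism of abelian varieties sends the unit point to the unit point (Mathlib `MonObj.one_comp`).
[cite: Milne2005ShimuraVarieties, §11 p. 108] -/
theorem map_hom_one (f : A ⟶ B) : AlgPoints.map f.hom.hom.hom (1 : A.Points Ω) = 1 :=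
  MonObj.one_comp f.hom.hom.hom

/-- `e.hom ≫ e.inv = 𝟙` on the underlying `K`-schemes of an isomorphism of abelian varieties. [cite: GortzWedhorn2020, Section (4.7), Prop. 4.16] -/
theorem iso_hom_hom_hom_hom_comp_inv (e : A ≅ A') : e.hom.hom.hom.hom ≫ e.inv.hom.hom.hom = 𝟙 A.X := by
  change (e.hom ≫ e.inv).hom.hom.hom = _
  rw [Iso.hom_inv_id]
  rfl

/-- `e.inv ≫ e.hom = 𝟙` on the underlying `K`-schemes of an isomorphism of abelian varieties. [cite: GortzWedhorn2020, Section (4.7), Prop. 4.16] -/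
theorem iso_inv_hom_hom_hom_comp_hom (e : A ≅ A') : e.inv.hom.hom.hom ≫ e.hom.hom.hom.hom = 𝟙 A'.X := by
  change (e.inv ≫ e.hom).hom.hom.hom = _
  rw [Iso.inv_hom_id]
  rfl

/-- An isomorphism of abelian varieties is INJECTIVE on `Ω`-points. [cite: Milne2005ShimuraVarieties, §11 p. 108] -/
theorem map_iso_hom_injective (e : A ≅ A') : Function.Injective (AlgPoints.map (L := Ω) e.hom.hom.hom.hom) := by
  intro P Q h
  have h' := congrArg (AlgPoints.map e.inv.hom.hom.hom) h
  rwa [← AlgPoints.map_comp_apply, ← AlgPoints.map_comp_apply, iso_hom_hom_hom_hom_comp_inv, AlgPoints.map_id_apply,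
    AlgPoints.map_id_apply] at h'

/-- An isomorphism of abelian varieties is SURJECTIVE on `Ω`-points. [cite: Milne2005ShimuraVarieties, §11 p. 108] -/
theorem map_iso_hom_surjective (e : A ≅ A') : Function.Surjective (AlgPoints.map (L := Ω) e.hom.hom.hom.hom) := fun Q =>
  ⟨AlgPoints.map e.inv.hom.hom.hom Q, by rw [← AlgPoints.map_comp_apply, iso_inv_hom_hom_hom_comp_hom, AlgPoints.map_id_apply]⟩

/-- **An isomorphism of abelian varieties detects the unit point**: `e(P) = 1 ↔ P = 1`. [cite: Milne2005ShimuraVarieties, §11 p. 108] -/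
theorem map_iso_hom_eq_one_iff (e : A ≅ A') (P : A.Points Ω) : AlgPoints.map e.hom.hom.hom.hom P = 1 ↔ P = 1 := by
  rw [← map_hom_one (Ω := Ω) e.hom]
  exact (map_iso_hom_injective e).eq_iff

/-- **KERNEL TRANSPORT ALONG A SQUARE WITH ISOMORPHISM SIDES (points).**  If `f ≫ e_B = e_A ≫ f′` with `e_A : A ≅ A′`, `e_B : B ≅ B′`
isomorphisms of abelian varieties, then for every `Ω`-point `P` of `A`: `f(P) = 1 ↔ f′(e_A(P)) = 1`.
[cite: Milne2005ShimuraVarieties, §14 pp. 124–125] [cite: GortzWedhorn2020, (4.15) and Definition 4.45 (2)] -/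
theorem map_eq_one_iff_of_sq (eA : A ≅ A') (eB : B ≅ B') {f : A ⟶ B} {f' : A' ⟶ B'} (h : f ≫ eB.hom = eA.hom ≫ f')
    (P : A.Points Ω) :
    AlgPoints.map f.hom.hom.hom P = 1 ↔ AlgPoints.map f'.hom.hom.hom (AlgPoints.map eA.hom.hom.hom.hom P) = 1 := by
  rw [← map_iso_hom_eq_one_iff eB (AlgPoints.map f.hom.hom.hom P), ← AlgPoints.map_comp_apply, ← AlgPoints.map_comp_apply]
  have h' : f.hom.hom.hom ≫ eB.hom.hom.hom.hom = eA.hom.hom.hom.hom ≫ f'.hom.hom.hom := by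
    change (f ≫ eB.hom).hom.hom.hom = (eA.hom ≫ f').hom.hom.hom
    rw [h]
  rw [h']

/-- **`e_A` carries the kernel of `f` on points ONTO the kernel of `f′`** (set form: `e_A '' {P ∣ f(P) = 1} = {Q ∣ f′(Q) = 1}`).
[cite: Milne2005ShimuraVarieties, §14 pp. 124–125] [cite: GortzWedhorn2020, (4.15) and Definition 4.45 (2)] -/
theorem image_ker_eq_of_sq (eA : A ≅ A') (eB : B ≅ B') {f : A ⟶ B} {f' : A' ⟶ B'} (h : f ≫ eB.hom = eA.hom ≫ f') :
    AlgPoints.map eA.hom.hom.hom.hom '' {P : A.Points Ω | AlgPoints.map f.hom.hom.hom P = 1} =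
      {Q : A'.Points Ω | AlgPoints.map f'.hom.hom.hom Q = 1} := by
  ext Q
  constructor
  · rintro ⟨P, hP, rfl⟩
    exact (map_eq_one_iff_of_sq eA eB h P).mp hP
  · intro hQ
    obtain ⟨P, rfl⟩ := map_iso_hom_surjective eA Q
    exact ⟨P, (map_eq_one_iff_of_sq eA eB h P).mpr hQ, rfl⟩

end AbelianVariety

end Literature.AlgebraicGeometry.Motives

namespace Literature.AlgebraicGeometry.AbelianSchemes

namespace AbelianSchemeOver

open Literature.AlgebraicGeometry.Motives Literature.AlgebraicGeometry.GroupSchemes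
open scoped MonObj

/-! ## §1 Kernels under the conjugate-fibre identification `(A_s)^σ ≅ A_{Spec σ ≫ s}` -/

section Conjugate

variable {S₀ : Scheme.{u}} {A B : AbelianSchemeOver S₀} {L : Type u} [Field L] (σ : L ≃+* L)
  (s : Spec (.of L) ⟶ S₀) {Ω : Type u} [Field Ω] [Algebra L Ω]

/-- Points of the conjugate fibre killed by `(f_s)^σ` are the points killed by `f_{Spec σ ≫ s}` after `e_A = conjFibreIso`.
[cite: Milne2005ShimuraVarieties, §14 pp. 124–125] -/
theorem map_fibreHom_specTwist_eq_one_iff (f : A.X ⟶ B.X) [IsMonHom f]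
    (Q : ((A.fibre s).toAbelianVariety.conjugate σ).Points Ω) :
    AlgPoints.map (AbelianVariety.Hom.conjugate σ (fibreHom f s)).hom.hom.hom Q = 1 ↔
      AlgPoints.map (fibreHom f (specTwist σ ≫ s)).hom.hom.hom (AlgPoints.map (A.conjFibreIso σ s).hom.hom.hom.hom Q) = 1 :=
  AbelianVariety.map_eq_one_iff_of_sq (A.conjFibreIso σ s) (B.conjFibreIso σ s) (conjugate_fibreHom_comp_conjFibreIso_hom σ s f) Q

/-- **`σ` CARRIES `ker f_s` ONTO `ker f_{Spec σ ≫ s}` ON POINTS**: for an `L`-point `P` of the fibre `A_s`,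
`f_s(P) = 1 ↔ f_{Spec σ ≫ s}(e_A(P^σ)) = 1` (`P ↦ P^σ` = ★ `conjPoints`, a group isomorphism; ★ `conjPoints_map`).  For `f = ι(a)`,
`λ`, or an isogeny this is Milne's «`σ(A, i, λ, ηK)`» read on kernels ∕ level subgroups. [cite: Milne2005ShimuraVarieties, §14 pp. 124–125]
[cite: Shimura1998, §18.6 proof of Thm. 18.6, p. 128] -/
theorem map_fibreHom_eq_one_iff_conjPoints (f : A.X ⟶ B.X) [IsMonHom f] (P : (A.fibre s).toAbelianVariety.Points L) :
    AlgPoints.map (fibreHom f s).hom.hom.hom P = 1 ↔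
      AlgPoints.map (fibreHom f (specTwist σ ≫ s)).hom.hom.hom
        (AlgPoints.map (A.conjFibreIso σ s).hom.hom.hom.hom ((A.fibre s).toAbelianVariety.conjPoints σ P)) = 1 := by
  rw [← map_fibreHom_specTwist_eq_one_iff σ s f, ← AbelianVariety.conjPoints_map, MulEquiv.map_eq_one_iff]

/-- Set form: `e_A ∘ (·)^σ` maps `{P ∈ A_s(L) ∣ f_s(P) = 1}` ONTO `{Q ∈ A_{Spec σ ≫ s}(L) ∣ f_{Spec σ ≫ s}(Q) = 1}`.
[cite: Milne2005ShimuraVarieties, §14 pp. 124–125] -/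
theorem image_conj_ker_eq (f : A.X ⟶ B.X) [IsMonHom f] :
    (fun P => AlgPoints.map (A.conjFibreIso σ s).hom.hom.hom.hom ((A.fibre s).toAbelianVariety.conjPoints σ P)) ''
        {P : (A.fibre s).toAbelianVariety.Points L | AlgPoints.map (fibreHom f s).hom.hom.hom P = 1} =
      {Q : (A.fibre (specTwist σ ≫ s)).toAbelianVariety.Points L | AlgPoints.map (fibreHom f (specTwist σ ≫ s)).hom.hom.hom Q = 1} := by
  ext Q
  constructor
  · rintro ⟨P, hP, rfl⟩
    exact (map_fibreHom_eq_one_iff_conjPoints σ s f P).mp hP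
  · intro hQ
    obtain ⟨Q', rfl⟩ := AbelianVariety.map_iso_hom_surjective (A.conjFibreIso σ s) Q
    obtain ⟨P, rfl⟩ := ((A.fibre s).toAbelianVariety.conjPoints σ).surjective Q'
    exact ⟨P, (map_fibreHom_eq_one_iff_conjPoints σ s f P).mpr hQ, rfl⟩

end Conjugate

/-! ## §2 Kernels under the Frobenius identification `A_{x ≫ F_S} ≅ (A_x)^{(q)}` -/

section Frobenius

variable {k : Type u} [Field k] [Finite k] {S : SchemeOver k} {A B : AbelianSchemeOver S.left} {L : Type u} [Field L]
  [Algebra k L] (p r : ℕ) [ExpChar L p] [PerfectRing L p] {Ω : Type u} [Field Ω] [Algebra L Ω]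

/-- **THE KERNEL AT THE FROBENIUS-MOVED POINT IS THE KERNEL OF THE FROBENIUS TWIST** (points): for an `Ω`-point `Q` of `A_{x ≫ F_S}`,
`f_{x ≫ F_S}(Q) = 1 ↔ (f_x)^{(q)}(e_A(Q)) = 1` (`e_A` = ★ `fibreFrobeniusTwistIso`; Shimura's «`β^f`»).
[cite: Shimura1998, §18.6 proof of Thm. 18.6, pp. 127–128] -/
theorem map_fibreHom_frobeniusOver_eq_one_iff (hq : Nat.card k = p ^ r) (x : specOver k L ⟶ S) (f : A.X ⟶ B.X) [IsMonHom f]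
    (Q : (A.fibre (x ≫ frobeniusOver S).left).toAbelianVariety.Points Ω) :
    AlgPoints.map (fibreHom f (x ≫ frobeniusOver S).left).hom.hom.hom Q = 1 ↔
      AlgPoints.map (AbelianVariety.Hom.frobeniusTwist p r (fibreHom f x.left)).hom.hom.hom
        (AlgPoints.map (A.fibreFrobeniusTwistIso p r hq x).hom.hom.hom.hom Q) = 1 :=
  AbelianVariety.map_eq_one_iff_of_sq (A.fibreFrobeniusTwistIso p r hq x) (B.fibreFrobeniusTwistIso p r hq x)
    (fibreHom_comp_fibreFrobeniusTwistIso_hom p r hq x f) Q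

/-- Set form: `e_A` maps `{Q ∣ f_{x ≫ F_S}(Q) = 1}` ONTO `{Q′ ∣ (f_x)^{(q)}(Q′) = 1}`. [cite: Shimura1998, §18.6 proof of Thm. 18.6, pp. 127–128] -/
theorem image_frobenius_ker_eq (hq : Nat.card k = p ^ r) (x : specOver k L ⟶ S) (f : A.X ⟶ B.X) [IsMonHom f] :
    AlgPoints.map (A.fibreFrobeniusTwistIso p r hq x).hom.hom.hom.hom ''
        {Q : (A.fibre (x ≫ frobeniusOver S).left).toAbelianVariety.Points Ω |
          AlgPoints.map (fibreHom f (x ≫ frobeniusOver S).left).hom.hom.hom Q = 1} =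
      {Q' : ((A.fibre x.left).toAbelianVariety.frobeniusTwist p r).Points Ω |
          AlgPoints.map (AbelianVariety.Hom.frobeniusTwist p r (fibreHom f x.left)).hom.hom.hom Q' = 1} :=
  AbelianVariety.image_ker_eq_of_sq _ _ (fibreHom_comp_fibreFrobeniusTwistIso_hom p r hq x f)

end Frobenius

/-! ## §3 Kernels under the base-change identification `(A ×_S S′)_t ≅ A_{t ≫ g}` -/

section BaseChange

variable {S S' : Scheme.{u}} {A B : AbelianSchemeOver S} (g : S' ⟶ S) {Ω : Type u} [Field Ω] (t : Spec (.of Ω) ⟶ S')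
  {Ω' : Type u} [Field Ω'] [Algebra Ω Ω']

/-- **RESTRICTION DOES NOT CHANGE KERNELS ON FIBRES** (points): `(f ×_S S′)_t(Q) = 1 ↔ f_{t ≫ g}(e_A(Q)) = 1`
(`e_A` = ★ `fibreBaseChangeIso`). [cite: GortzWedhorn2020, Section (4.7), Prop. 4.16] [cite: GortzWedhorn2020, (4.15) and Definition 4.45 (2)] -/
theorem map_fibreHom_baseChangeHom_eq_one_iff (f : A.X ⟶ B.X) [IsMonHom f]
    (Q : ((A.baseChange g).fibre t).toAbelianVariety.Points Ω') :
    haveI := isMonHom_baseChangeHom f g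
    AlgPoints.map (fibreHom (baseChangeHom f g) t).hom.hom.hom Q = 1 ↔
      AlgPoints.map (fibreHom f (t ≫ g)).hom.hom.hom (AlgPoints.map (A.fibreBaseChangeIso g t).hom.hom.hom.hom Q) = 1 := by
  haveI := isMonHom_baseChangeHom f g
  exact AbelianVariety.map_eq_one_iff_of_sq (A.fibreBaseChangeIso g t) (B.fibreBaseChangeIso g t)
    (fibreHom_baseChangeHom_comp_fibreBaseChangeIso_hom g t f) Q

/-- Set form: `e_A` maps `{Q ∣ (f ×_S S′)_t(Q) = 1}` ONTO `{Q′ ∣ f_{t ≫ g}(Q′) = 1}`. [cite: GortzWedhorn2020, Section (4.7), Prop. 4.16] -/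
theorem image_baseChange_ker_eq (f : A.X ⟶ B.X) [IsMonHom f] :
    haveI := isMonHom_baseChangeHom f g
    AlgPoints.map (A.fibreBaseChangeIso g t).hom.hom.hom.hom ''
        {Q : ((A.baseChange g).fibre t).toAbelianVariety.Points Ω' | AlgPoints.map (fibreHom (baseChangeHom f g) t).hom.hom.hom Q = 1} =
      {Q' : (A.fibre (t ≫ g)).toAbelianVariety.Points Ω' | AlgPoints.map (fibreHom f (t ≫ g)).hom.hom.hom Q' = 1} := by
  haveI := isMonHom_baseChangeHom f g
  exact AbelianVariety.image_ker_eq_of_sq _ _ (fibreHom_baseChangeHom_comp_fibreBaseChangeIso_hom g t f)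

end BaseChange

end AbelianSchemeOver

end Literature.AlgebraicGeometry.AbelianSchemes

/-! ## §4 Generic scheme form: the kernel group scheme along a square with isomorphism sides -/

namespace Literature.AlgebraicGeometry.Motives

namespace AbelianVariety

open Literature.AlgebraicGeometry.GroupSchemes GroupSchemeKernel
open scoped MonObj

/-- **`Ker φ ≅ Ker φ′` OVER `e_G` for a square `φ ≫ e_H = e_G ≫ φ′` of homomorphisms of group objects with isomorphism sides**
(any cartesian monoidal category with the two kernels; ★ `kerLift` both ways).  `e_H` is only used through «`e_H(1) = 1`».
[cite: GortzWedhorn2020, (4.15) and Definition 4.45 (2)] -/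
theorem exists_kerIso_of_sq {C : Type u} [Category.{v} C] [CartesianMonoidalCategory C] {G H G' H' : C} [GrpObj H] [GrpObj H']
    (φ : G ⟶ H) (φ' : G' ⟶ H') [HasPullback φ η[H]] [HasPullback φ' η[H']] (eG : G ≅ G') (eH : H ≅ H') [IsMonHom eH.hom]
    (h : φ ≫ eH.hom = eG.hom ≫ φ') :
    ∃ e : ker φ ≅ ker φ', e.hom ≫ kerι φ' = kerι φ ≫ eG.hom ∧ e.inv ≫ kerι φ = kerι φ' ≫ eG.inv := by
  have h1 : (kerι φ ≫ eG.hom) ≫ φ' = 1 := by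
    rw [Category.assoc, ← h, ← Category.assoc, kerι_comp, MonObj.one_comp]
  have hinv : φ' ≫ eH.inv = eG.inv ≫ φ := by
    rw [Iso.comp_inv_eq, Category.assoc, h, Iso.inv_hom_id_assoc]
  have hone : (1 : ker φ' ⟶ H') ≫ eH.inv = 1 := by
    rw [← MonObj.one_comp eH.hom, Category.assoc, Iso.hom_inv_id, Category.comp_id]
  have h2 : (kerι φ' ≫ eG.inv) ≫ φ = 1 := by
    rw [Category.assoc, ← hinv, ← Category.assoc, kerι_comp, hone]
  refine ⟨⟨kerLift (kerι φ ≫ eG.hom) h1, kerLift (kerι φ' ≫ eG.inv) h2, ?_, ?_⟩, kerLift_ι _ h1, kerLift_ι _ h2⟩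
  · exact ker_hom_ext (by rw [Category.assoc, kerLift_ι, ← Category.assoc, kerLift_ι, Category.assoc, Iso.hom_inv_id,
      Category.comp_id, Category.id_comp])
  · exact ker_hom_ext (by rw [Category.assoc, kerLift_ι, ← Category.assoc, kerLift_ι, Category.assoc, Iso.inv_hom_id,
      Category.comp_id, Category.id_comp])

variable {K : Type u} [Field K] {A B A' B' : AbelianVariety K}

/-- **Abelian-variety form**: for `f ≫ e_B = e_A ≫ f′` with `e_A`, `e_B` isomorphisms of abelian varieties over `K`, the kernel group
schemes `Ker f`, `Ker f′` (★ `GroupSchemeKernel.ker` of the underlying homomorphisms of `K`-group schemes) are isomorphic over `e_A`.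
[cite: GortzWedhorn2020, (4.15) and Definition 4.45 (2)] [cite: Milne2005ShimuraVarieties, §14 pp. 124–125] -/
theorem exists_kerIso_of_av_sq (eA : A ≅ A') (eB : B ≅ B') {f : A ⟶ B} {f' : A' ⟶ B'} (h : f ≫ eB.hom = eA.hom ≫ f') :
    ∃ e : ker f.hom.hom.hom ≅ ker f'.hom.hom.hom,
      e.hom ≫ kerι f'.hom.hom.hom = kerι f.hom.hom.hom ≫ eA.hom.hom.hom.hom ∧
        e.inv ≫ kerι f.hom.hom.hom = kerι f'.hom.hom.hom ≫ eA.inv.hom.hom.hom := by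
  have h' : f.hom.hom.hom ≫ eB.hom.hom.hom.hom = eA.hom.hom.hom.hom ≫ f'.hom.hom.hom := by
    change (f ≫ eB.hom).hom.hom.hom = (eA.hom ≫ f').hom.hom.hom
    rw [h]
  exact exists_kerIso_of_sq f.hom.hom.hom f'.hom.hom.hom
    ⟨eA.hom.hom.hom.hom, eA.inv.hom.hom.hom, iso_hom_hom_hom_hom_comp_inv eA, iso_inv_hom_hom_hom_comp_hom eA⟩
    ⟨eB.hom.hom.hom.hom, eB.inv.hom.hom.hom, iso_hom_hom_hom_hom_comp_inv eB, iso_inv_hom_hom_hom_comp_hom eB⟩ h'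

end AbelianVariety

end Literature.AlgebraicGeometry.Motives

/-! ## §5 The three instances: kernel group schemes of the fibres -/

namespace Literature.AlgebraicGeometry.AbelianSchemes

namespace AbelianSchemeOver

open Literature.AlgebraicGeometry.Motives Literature.AlgebraicGeometry.GroupSchemes GroupSchemeKernel
open scoped MonObj

/-- **`Ker (f_s)^σ ≅ Ker f_{Spec σ ≫ s}` over `conjFibreIso`** (kernel group schemes over `L`). [cite: Milne2005ShimuraVarieties, §14 pp. 124–125]
[cite: GortzWedhorn2020, (4.15) and Definition 4.45 (2)] -/
theorem exists_kerIso_fibreHom_specTwist {S₀ : Scheme.{u}} {A B : AbelianSchemeOver S₀} {L : Type u} [Field L] (σ : L ≃+* L)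
    (s : Spec (.of L) ⟶ S₀) (f : A.X ⟶ B.X) [IsMonHom f] :
    ∃ e : ker (AbelianVariety.Hom.conjugate σ (fibreHom f s)).hom.hom.hom ≅ ker (fibreHom f (specTwist σ ≫ s)).hom.hom.hom,
      e.hom ≫ kerι _ = kerι _ ≫ (A.conjFibreIso σ s).hom.hom.hom.hom ∧ e.inv ≫ kerι _ = kerι _ ≫ (A.conjFibreIso σ s).inv.hom.hom.hom :=
  AbelianVariety.exists_kerIso_of_av_sq _ _ (conjugate_fibreHom_comp_conjFibreIso_hom σ s f)

/-- **`Ker f_{x ≫ F_S} ≅ Ker (f_x)^{(q)}` over `fibreFrobeniusTwistIso`** (kernel group schemes over `L`).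
[cite: Shimura1998, §18.6 proof of Thm. 18.6, pp. 127–128] [cite: GortzWedhorn2020, (4.15) and Definition 4.45 (2)] -/
theorem exists_kerIso_fibreHom_frobeniusOver {k : Type u} [Field k] [Finite k] {S : SchemeOver k} {A B : AbelianSchemeOver S.left}
    {L : Type u} [Field L] [Algebra k L] (p r : ℕ) [ExpChar L p] [PerfectRing L p] (hq : Nat.card k = p ^ r) (x : specOver k L ⟶ S)
    (f : A.X ⟶ B.X) [IsMonHom f] :
    ∃ e : ker (fibreHom f (x ≫ frobeniusOver S).left).hom.hom.hom ≅ ker (AbelianVariety.Hom.frobeniusTwist p r (fibreHom f x.left)).hom.hom.hom,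
      e.hom ≫ kerι _ = kerι _ ≫ (A.fibreFrobeniusTwistIso p r hq x).hom.hom.hom.hom ∧
        e.inv ≫ kerι _ = kerι _ ≫ (A.fibreFrobeniusTwistIso p r hq x).inv.hom.hom.hom :=
  AbelianVariety.exists_kerIso_of_av_sq _ _ (fibreHom_comp_fibreFrobeniusTwistIso_hom p r hq x f)

/-- **`Ker (f ×_S S′)_t ≅ Ker f_{t ≫ g}` over `fibreBaseChangeIso`** (kernel group schemes over `Ω`). [cite: GortzWedhorn2020, Section (4.7), Prop. 4.16]
[cite: GortzWedhorn2020, (4.15) and Definition 4.45 (2)] -/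
theorem exists_kerIso_fibreHom_baseChangeHom {S S' : Scheme.{u}} {A B : AbelianSchemeOver S} (g : S' ⟶ S) {Ω : Type u} [Field Ω]
    (t : Spec (.of Ω) ⟶ S') (f : A.X ⟶ B.X) [IsMonHom f] :
    haveI := isMonHom_baseChangeHom f g
    ∃ e : ker (fibreHom (baseChangeHom f g) t).hom.hom.hom ≅ ker (fibreHom f (t ≫ g)).hom.hom.hom,
      e.hom ≫ kerι _ = kerι _ ≫ (A.fibreBaseChangeIso g t).hom.hom.hom.hom ∧
        e.inv ≫ kerι _ = kerι _ ≫ (A.fibreBaseChangeIso g t).inv.hom.hom.hom := by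
  haveI := isMonHom_baseChangeHom f g
  exact AbelianVariety.exists_kerIso_of_av_sq _ _ (fibreHom_baseChangeHom_comp_fibreBaseChangeIso_hom g t f)

end AbelianSchemeOver

end Literature.AlgebraicGeometry.AbelianSchemes

end
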